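import Summits.AtomisticToContinuum.HydrodynamicLimit.Theses.OneSphereInfluence
import Summits.AtomisticToContinuum.HydrodynamicLimit.Theorems.OneSphereInfluenceAssembly
import Literature.Analysis.FluidPDE.LinearizedHsEulerFamily
import HarnessLib

/-!
# Route `OneSphereInfluence`: the glue `MeanVarianceL2` (stmt-AtomisticToContinuum-13622)

`MeanVarianceL2 : ScoreLinearResponse → ResamplingInfluence → HardCorePoincare →
HomogeneousInvariance → PreShockHomotopy → L2HydroFields` — the glue of the route: the three
one-sphere cruxes and the two anchoring statements give MEAN-SQUARE convergence of the three
empirical fields (the shared typed waypoint `L2HydroFields`). Same proof as the assembly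
(`OneSphereInfluenceAssembly.lean`) with the mean-square conclusion
`tendsto_lintegral_sq_of_uniform_covariance` (`E|F - c|² = Var F + (E F - c)²`) in place of
Chebyshev; the momentum field is treated coordinatewise (`‖w‖² = ∑ₗ wₗ²`).

References: H. Spohn, *Large Scale Dynamics of Interacting Particles* (1991), Part I Ch. 3,
Part II §7.1; B. Efron, C. Stein, Ann. Statist. 9 (1981) 586–596.
-/

noncomputable section

open MeasureTheory ProbabilityTheory Filter Set Topology Real
open scoped InnerProductSpace ENNReal

namespace Summit.AtomisticToContinuum.HydrodynamicLimit.Theorems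

open Literature.Analysis.FluidPDE Literature.MathematicalPhysics.KineticTheory
open Summit.AtomisticToContinuum.HydrodynamicLimit.Theses.OneSphereInfluence
open OneSphereInfluenceAssembly

/-! ## The glue `MeanVarianceL2` -/

/-- **Route `OneSphereInfluence`, glue `MeanVarianceL2` (stmt-AtomisticToContinuum-13622).** The
three one-sphere cruxes, the support `HomogeneousInvariance` and the pre-shock homotopy imply the
shared waypoint `L2HydroFields`: mean-square convergence of the empirical density, momentum and
energy fields at every `t < T` (mean from the score identity + mean-value in `κ` anchored at the
flow-invariant constant state, variance from Poincaré × resampling influence,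
`E|F - c|² = Var F + (E F - c)²`). [folklore] -/
theorem oneSphereInfluence_meanVarianceL2 :
    Summit.AtomisticToContinuum.HydrodynamicLimit.Theses.OneSphereInfluence.MeanVarianceL2 := by
  intro hS hR hH hI hP a₁ θ₁ u₁ ha₁ hθ₁ hu₁ ha₁0 hθ₁0
  obtain ⟨Λ, hΛ, σP, hσP, hPσ⟩ := hP a₁ θ₁ u₁ ha₁ hθ₁ hu₁ ha₁0 hθ₁0
  obtain ⟨σS, hσS, hSσ⟩ := hS a₁ θ₁ u₁ ha₁ hθ₁ hu₁ ha₁0 hθ₁0 Λ hΛ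
  obtain ⟨σR, hσR, hRσ⟩ := hR a₁ θ₁ u₁ ha₁ hθ₁ hu₁ ha₁0 hθ₁0
  obtain ⟨σH, hσH, hHσ⟩ := hH a₁ θ₁ u₁ ha₁ hθ₁ hu₁ ha₁0 hθ₁0
  refine ⟨min (min σP σS) (min σR σH), lt_min (lt_min hσP hσS) (lt_min hσR hσH), ?_⟩
  intro σ hσ hσlt T ρ θ u hsol Φ hinit t ht
  have hσP' : σ < σP := lt_of_lt_of_le hσlt ((min_le_left _ _).trans (min_le_left _ _))
  have hσS' : σ < σS := lt_of_lt_of_le hσlt ((min_le_left _ _).trans (min_le_right _ _))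
  have hσR' : σ < σR := lt_of_lt_of_le hσlt ((min_le_right _ _).trans (min_le_left _ _))
  have hσH' : σ < σH := lt_of_lt_of_le hσlt ((min_le_right _ _).trans (min_le_right _ _))
  -- the pre-shock homotopy through `t`
  obtain ⟨T', htT', a, θ₀, u₀, ρh, θh, uh, ha, hθs, hus, hhull, hconst, ha1, hθ1, hu1, hsols, hρc, huc, hθc,
    hlln, hprobL, hρ1, hu1', hθ1', hconst0⟩ := hPσ σ hσ hσP' T ρ θ u hsol Φ hinit t ht
  obtain ⟨C, hC, hPI⟩ := hHσ σ hσ hσH'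
  have hRt := hRσ σ hσ hσR' T ρ θ u hsol Φ hinit t ht
  subst ha1 hθ1 hu1 hρ1 hu1' hθ1'
  have htI : t ∈ Ico 0 T' := ⟨ht.1, htT'⟩
  have hT' : (0 : ℝ) < T' := ht.1.trans_lt htT'
  have h0T : (0 : ℝ) ∈ Ico 0 T' := ⟨le_rfl, hT'⟩
  have h0I : (0 : ℝ) ∈ Icc (0 : ℝ) 1 := ⟨le_rfl, zero_le_one⟩
  have h1I : (1 : ℝ) ∈ Icc (0 : ℝ) 1 := ⟨zero_le_one, le_rfl⟩
  have hSt := hSσ σ hσ hσS' a θ₀ u₀ ha hθs hus hhull hconst rfl rfl rfl T' ρh θh uh hsols hρc huc hθc Φ hlln t htI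
  -- positivity of the path profiles
  have hinf : 0 < Λ⁻¹ * ⨅ y, a 1 y :=
    mul_pos (inv_pos.2 (zero_lt_one.trans_le hΛ)) (iInf_pos_of_continuous ha₁ ha₁0)
  have ha0 : ∀ κ ∈ Icc (0 : ℝ) 1, ∀ x, 0 < a κ x := fun κ hκ x => hinf.trans_le (hhull κ hκ x).1
  have hθ0 : ∀ κ ∈ Icc (0 : ℝ) 1, ∀ x, 0 < θ₀ κ x := fun κ hκ x => (hhull κ hκ x).2.2
  have hprobM : ∀ κ ∈ Icc (0 : ℝ) 1, ∀ N, IsProbabilityMeasure (localGibbsMeasure σ (a κ) (u₀ κ) (θ₀ κ) N) :=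
    fun κ hκ N => by rw [← localGibbsLaw_eq σ _ _ _ N (Φ N)]; exact hprobL κ hκ N
  -- the constant state at `κ = 0`
  have hcpos : 0 < a 0 0 := ha0 0 h0I 0
  have hθcpos : 0 < θ₀ 0 0 := hθ0 0 h0I 0
  have hlaw0 : ∀ N, localGibbsLaw σ (a 0) (u₀ 0) (θ₀ 0) N (Φ N) =
      localGibbsLaw σ (fun _ => a 0 0) (fun _ => u₀ 0 0) (fun _ => θ₀ 0 0) N (Φ N) := fun N => by
    congr 1 <;> funext x
    exacts [(hconst x).1, (hconst x).2.2, (hconst x).2.1]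
  have hmeas0 : ∀ N, localGibbsMeasure σ (a 0) (u₀ 0) (θ₀ 0) N =
      localGibbsMeasure σ (fun _ => a 0 0) (fun _ => u₀ 0 0) (fun _ => θ₀ 0 0) N := fun N => by
    rw [← localGibbsLaw_eq σ _ _ _ N (Φ N), hlaw0, localGibbsLaw_eq]
  have hinv : ∀ (N : ℕ) (s : ℝ), (Φ N).lawAt (localGibbsLaw σ (fun _ => a 0 0) (fun _ => u₀ 0 0)
      (fun _ => θ₀ 0 0) N (Φ N)) s = localGibbsLaw σ (fun _ => a 0 0) (fun _ => u₀ 0 0) (fun _ => θ₀ 0 0) N (Φ N) :=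
    fun N s => hI σ (a 0 0) (θ₀ 0 0) (u₀ 0 0) hσ hcpos hθcpos N (Φ N) s
  have hprobc : ∀ N, IsProbabilityMeasure (localGibbsMeasure σ (fun _ => a 0 0) (fun _ => u₀ 0 0)
      (fun _ => θ₀ 0 0) N) := fun N => by rw [← hmeas0]; exact hprobM 0 h0I N
  -- continuity of the slices of the Euler family
  have hρcont : ∀ κ ∈ Icc (0 : ℝ) 1, Continuous (ρh κ t) := fun κ hκ =>
    ((hsols κ hκ).smooth_density.isSmooth_slice htI).continuous
  have hucont : ∀ κ ∈ Icc (0 : ℝ) 1, Continuous (uh κ t) := fun κ hκ =>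
    ((hsols κ hκ).smooth_velocity.isSmooth_slice htI).continuous
  have hρcont0 : Continuous (ρh 0 0) := ((hsols 0 h0I).smooth_density.isSmooth_slice h0T).continuous
  have hucont0 : Continuous (uh 0 0) := ((hsols 0 h0I).smooth_velocity.isSmooth_slice h0T).continuous
  intro χ hχ
  obtain ⟨Cχ, hCχ0, hCχ⟩ := exists_forall_abs_le_of_continuous hχ
  have hSχ := hSt χ hχ
  have hRχ := hRt χ hχ
  dsimp only at hSχ hRχ
  obtain ⟨hSd, hSm, hSe⟩ := hSχ
  obtain ⟨hRd, hRm, hRe⟩ := hRχ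
  simp_rw [localGibbsLaw_eq] at hSd hSm hSe hRd hRm hRe hPI ⊢
  -- the common core, for one scalar observable
  have core : ∀ (F₀ : (N : ℕ) → Config (N + 1) (Fin 3) T3 → ℝ) (G : ℝ → ℝ) (k : Fin 5),
      (∀ N, Continuous (F₀ N)) →
      (∀ N z, |F₀ N z| ≤ Cχ * (1 + (((N + 1 : ℕ) : ℝ))⁻¹ * ∑ i, ‖(z i).2‖ ^ 2)) →
      (∀ N, ∀ z ∈ (Φ N).good, |F₀ N ((Φ N).flow t z)| ≤ Cχ * (1 + (((N + 1 : ℕ) : ℝ))⁻¹ * ∑ i, ‖(z i).2‖ ^ 2)) →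
      (∀ κ, G κ = ∫ x, χ x * (consState (ρh κ t x) (uh κ t x) (θh κ t x)) k) →
      ∀ c₀ : ℝ, c₀ = G 0 →
      TendstoUniformlyOn (fun N κ => cov[fun z => ∑ i, derivWithin
          (fun κ' => Real.log (localGibbsProfile (a κ') (u₀ κ') (θ₀ κ') (z i))) (Icc 0 1) κ,
          fun z => F₀ N ((Φ N).flow t z); localGibbsMeasure σ (a κ) (u₀ κ) (θ₀ κ) N])
        (fun κ => derivWithin G (Icc 0 1) κ) atTop (Icc 0 1) →
      (∀ δ' > (0 : ℝ), Tendsto (fun N => localGibbsLaw σ (a 0) (u₀ 0) (θ₀ 0) N (Φ N)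
        {z | δ' < |F₀ N ((Φ N).flow 0 z) - c₀|}) atTop (𝓝 0)) →
      Tendsto (fun N => ∑ i : Fin (N + 1), ∫ z, condVar (MeasurableSpace.comap
          (fun (z : Config (N + 1) (Fin 3) T3) (j : Fin N) => z (i.succAbove j)) MeasurableSpace.pi)
          (fun z => F₀ N ((Φ N).flow t z)) (localGibbsMeasure σ (a 1) (u₀ 1) (θ₀ 1) N) z
          ∂localGibbsMeasure σ (a 1) (u₀ 1) (θ₀ 1) N) atTop (𝓝 0) →
      Tendsto (fun N => ∫⁻ z, ENNReal.ofReal (|F₀ N ((Φ N).flow t z) - G 1| ^ 2)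
        ∂localGibbsMeasure σ (a 1) (u₀ 1) (θ₀ 1) N) atTop (𝓝 0) := by
    intro F₀ G k hF₀c hF₀b hFb hGeq c₀ hc₀ hcov hlln0 hRF
    have hFm : ∀ N, Measurable fun z => F₀ N ((Φ N).flow t z) := fun N =>
      (hF₀c N).measurable.comp ((Φ N).measurable_flow t)
    -- differentiability of the limit field within `[0,1]`
    have hG : ∀ κ ∈ Icc (0 : ℝ) 1, DifferentiableWithinAt ℝ G (Icc 0 1) κ := by
      intro κ hκ
      have h := (hasDerivWithinAt_integral_mul_consState_apply hρc huc hθc htI hχ k hκ).differentiableWithinAt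
      rw [show G = fun κ' => ∫ x, χ x * (consState (ρh κ' t x) (uh κ' t x) (θh κ' t x)) k from funext hGeq]
      exact h
    -- the `κ = 0` anchor
    have h0 : Tendsto (fun N => ∫ z, F₀ N ((Φ N).flow t z) ∂localGibbsMeasure σ (a 0) (u₀ 0) (θ₀ 0) N)
        atTop (𝓝 (G 0)) := by
      simp_rw [hmeas0, ← hc₀]
      refine tendsto_integral_comp_flow_const σ (a 0 0) (θ₀ 0 0) (u₀ 0 0) hθcpos hcpos.le Φ hinv hprobc
        (fun N => (hF₀c N).measurable) hCχ0 hF₀b (fun δ' hδ' => ?_) t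
      simpa only [hlaw0] using hlln0 δ' hδ'
    -- the variance
    have hmem : ∀ N, MemLp (fun z => F₀ N ((Φ N).flow t z)) 2 (localGibbsMeasure σ (a 1) (u₀ 1) (θ₀ 1) N) :=
      fun N => memLp_two_of_good ha hθs hus ha0 hθ0 σ (Φ N) (fun κ hκ => hprobM κ hκ N) h1I (hFm N) hCχ0 (hFb N)
    have hvar : Tendsto (fun N => Var[fun z => F₀ N ((Φ N).flow t z); localGibbsMeasure σ (a 1) (u₀ 1) (θ₀ 1) N])
        atTop (𝓝 0) :=
      tendsto_zero_of_le_mul (fun N => variance_nonneg _ _) (fun N => hPI N (Φ N) _ (hmem N)) hRF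
    exact tendsto_lintegral_sq_of_uniform_covariance ha hθs hus ha0 hθ0 σ Φ hprobM hFm hCχ0 hFb hG hcov h0 hvar
  -- constancy of the `κ = 0` member
  have hρ0t : ∀ x, ρh 0 t x = ρh 0 0 x := fun x => by rw [(hconst0 t htI x).1, (hconst0 0 h0T x).1]
  have hu0t : ∀ x, uh 0 t x = uh 0 0 x := fun x => by rw [(hconst0 t htI x).2.1, (hconst0 0 h0T x).2.1]
  have hθ0t : ∀ x, θh 0 t x = θh 0 0 x := fun x => by rw [(hconst0 t htI x).2.2, (hconst0 0 h0T x).2.2]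
  refine ⟨?_, ?_, ?_⟩
  · -- density
    have h := core (fun N z => empiricalDensityField z χ) (fun κ => ∫ x, χ x * ρh κ t x) 0
      (fun N => continuous_empiricalDensityField hχ) (fun N z => abs_empiricalDensityField_le z hCχ)
      (fun N z hz => abs_empiricalDensityField_flow_le (Φ N) hCχ t hz)
      (fun κ => by simp [consState]) (∫ x, χ x * ρh 0 0 x) (by simp only [hρ0t]) hSd
      (fun δ' hδ' => (hlln 0 h0I χ hχ δ' hδ').1) hRd
    simpa using h
  · -- momentum, coordinatewise
    set I : V3 := ∫ x, (χ x * ρh 1 t x) • uh 1 t x with hIdef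
    have hIl : ∀ l : Fin 3, I l = ∫ x, χ x * ρh 1 t x * uh 1 t x l := fun l =>
      integral_smul_apply hχ (hρcont 1 h1I) (hucont 1 h1I) l
    have hI0l : ∀ l : Fin 3, (∫ x, (χ x * ρh 0 0 x) • uh 0 0 x) l = ∫ x, χ x * ρh 0 0 x * uh 0 0 x l := fun l =>
      integral_smul_apply hχ hρcont0 hucont0 l
    have hcoord : ∀ l : Fin 3, Tendsto (fun N => ∫⁻ z, ENNReal.ofReal
        (|(empiricalMomentumField ((Φ N).flow t z) χ - I) l| ^ 2) ∂localGibbsMeasure σ (a 1) (u₀ 1) (θ₀ 1) N)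
        atTop (𝓝 0) := by
      intro l
      have h := core (fun N z => empiricalMomentumField z χ l) (fun κ => ∫ x, χ x * ρh κ t x * uh κ t x l)
        (HsState.momentumIdx l)
        (fun N => (continuous_apply l).comp
          ((PiLp.continuous_ofLp 2 _).comp (continuous_empiricalMomentumField hχ)))
        (fun N z => abs_empiricalMomentumField_apply_le z hCχ l)
        (fun N z hz => abs_empiricalMomentumField_flow_apply_le (Φ N) hCχ t l hz)
        (fun κ => by simp [consState, mul_assoc]) (∫ x, χ x * ρh 0 0 x * uh 0 0 x l)
        (by simp only [hρ0t, hu0t]) (hSm l)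
        (fun δ' hδ' => by
          have hv := tendsto_measure_lt_abs_apply_of_norm (hlln 0 h0I χ hχ δ' hδ').2.1 l
          refine hv.congr fun N => ?_
          congr 1
          ext z
          simp only [Set.mem_setOf_eq, PiLp.sub_apply, hI0l])
        (hRm l)
      refine h.congr fun N => ?_
      refine lintegral_congr fun z => ?_
      rw [PiLp.sub_apply, hIl]
    have hcm : ∀ (N : ℕ) (l : Fin 3), Measurable fun z : Config (N + 1) (Fin 3) T3 =>
        ENNReal.ofReal (|(empiricalMomentumField ((Φ N).flow t z) χ - I) l| ^ 2) := fun N l =>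
      ((continuous_abs.measurable.comp (((continuous_apply l).comp (PiLp.continuous_ofLp 2 _)).measurable.comp
        (((continuous_empiricalMomentumField hχ).measurable.comp ((Φ N).measurable_flow t)).sub
          measurable_const))).pow_const 2).ennreal_ofReal
    have hsplit : ∀ N, ∫⁻ z, ENNReal.ofReal (‖empiricalMomentumField ((Φ N).flow t z) χ - I‖ ^ 2)
        ∂localGibbsMeasure σ (a 1) (u₀ 1) (θ₀ 1) N = ∑ l, ∫⁻ z, ENNReal.ofReal
          (|(empiricalMomentumField ((Φ N).flow t z) χ - I) l| ^ 2) ∂localGibbsMeasure σ (a 1) (u₀ 1) (θ₀ 1) N := by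
      intro N
      rw [← lintegral_finsetSum' _ fun l _ => (hcm N l).aemeasurable]
      refine lintegral_congr fun z => ?_
      rw [EuclideanSpace.real_norm_sq_eq, ENNReal.ofReal_sum_of_nonneg fun l _ => sq_nonneg _]
      simp_rw [sq_abs]
    simp_rw [hsplit]
    have := tendsto_finsetSum (Finset.univ : Finset (Fin 3)) (fun l _ => hcoord l)
    simpa only [Finset.sum_const_zero] using this
  · -- energy
    have h := core (fun N z => empiricalEnergyField z χ)
      (fun κ => ∫ x, χ x * totalEnergyDensity (ρh κ t x) (uh κ t x) (θh κ t x)) 4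
      (fun N => continuous_empiricalEnergyField hχ) (fun N z => abs_empiricalEnergyField_le z hCχ)
      (fun N z hz => abs_empiricalEnergyField_flow_le (Φ N) hCχ t hz)
      (fun κ => by simp [consState]) (∫ x, χ x * totalEnergyDensity (ρh 0 0 x) (uh 0 0 x) (θh 0 0 x))
      (by simp only [hρ0t, hu0t, hθ0t]) hSe (fun δ' hδ' => (hlln 0 h0I χ hχ δ' hδ').2.2) hRe
    simpa using h

end Summit.AtomisticToContinuum.HydrodynamicLimit.Theorems

end
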